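import Mathlib

/-!
# The absorption lemma of the 2-sum closure for pieces of packing 2 (law level)
(seat mine-b, cell pub-perc-repro2; conjectures/MINE-B.md §13.3)

Two-colour pattern counts `H(i,j) = #{F_R = i, F_B ≥ j}`; STEP at the row `(i,j)` is
`H(i,j) ≤ H(i+1,j−1)`.  The 2-sum of a base (at an element `p`) with a piece of packing number ≤ 2
has, on every composite pattern, the count
  `N = w00·A + w10·B + w11·C + w20·R + w21·E + w22·F`
where `A, B, C, E, F` are the genuine pattern counts of the base with `p` doubled into a parallel
pair `p', p''` (`p` deleted / one copy split / one copy pinned / one pinned and one split / both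
pinned), `R = RR + BB` is the capacity-2 defect count (both copies given to one colour) and
`w_ab = #{piece colourings with red packing a, blue packing b}` (symmetric weights; the piece's own
pattern Reimer inequality is `w20 ≤ w11 + w21`, `absH_zero_two_le`).  The defect count `R` does not
satisfy STEP by itself (NEG-B14), but the piece's Reimer inequality absorbs it into the two
capacity-2 laws `M₁ = R + C` and `M₂ = R + E`:
  `N = w00·A + w10·B + (w11 − α)·C + (w21 − β)·E + α·M₁ + β·M₂ + w22·F`, `α = min(w20, w11)`,
`β = w20 − α ≤ w21`.  So STEP for `A, B, C, E, F, M₁, M₂` at a row gives STEP for `N` at that row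
(`absorb_step`), and the full closure statement for packing-2 pieces is this lemma plus the
capacity identity (the packing-2 analogue of `kDisj_twoSum_iff`, TwoSumPacking.lean).  The rows
(M1-STEP), (M2-STEP) — `M₁`, `M₂` satisfy STEP whenever the genuine patterns do — are the seat's
conjectured rows for clutters with a parallel pair (census-true on every binary port on ≤ 9 elements).
-/

namespace Summit.Ventures.PercRepro2

namespace TwoSumAbsorb

/-- **The absorption lemma.**  Real counts at the two rows `(i,j)` and `(i+1,j−1)` are abstracted as
pairs `(X, X')` with STEP meaning `X ≤ X'`.  Non-negative symmetric weights with the piece's Reimer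
inequality `w20 ≤ w11 + w21`, STEP for the five genuine counts and for the two capacity-2 laws
`R + C`, `R + E` give STEP for the composite count. -/
theorem absorb_step (w00 w10 w11 w20 w21 w22 : ℝ) (h00 : 0 ≤ w00) (h10 : 0 ≤ w10) (h11 : 0 ≤ w11)
    (h20 : 0 ≤ w20) (h21 : 0 ≤ w21) (h22 : 0 ≤ w22) (hR : w20 ≤ w11 + w21)
    (A A' B B' C C' E E' F F' R R' : ℝ) (hA : A ≤ A') (hB : B ≤ B') (hC : C ≤ C') (hE : E ≤ E')
    (hF : F ≤ F') (hM₁ : R + C ≤ R' + C') (hM₂ : R + E ≤ R' + E') :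
    w00 * A + w10 * B + w11 * C + w20 * R + w21 * E + w22 * F
      ≤ w00 * A' + w10 * B' + w11 * C' + w20 * R' + w21 * E' + w22 * F' := by
  have a0 := mul_le_mul_of_nonneg_left hA h00
  have a1 := mul_le_mul_of_nonneg_left hB h10
  have a5 := mul_le_mul_of_nonneg_left hF h22
  rcases le_or_gt w20 w11 with hle | hlt
  · -- `α = w20`, `β = 0`: `w11·C + w20·R = (w11 − w20)·C + w20·(R + C)`
    have a2 := mul_le_mul_of_nonneg_left hC (sub_nonneg.mpr hle)
    have a3 := mul_le_mul_of_nonneg_left hM₁ h20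
    have a4 := mul_le_mul_of_nonneg_left hE h21
    nlinarith
  · -- `α = w11`, `β = w20 − w11 ≤ w21`:
    -- `w11·C + w20·R + w21·E = w11·(R + C) + (w20 − w11)·(R + E) + (w21 − w20 + w11)·E`
    have hβ : 0 ≤ w20 - w11 := by linarith
    have hγ : 0 ≤ w21 - (w20 - w11) := by linarith
    have a2 := mul_le_mul_of_nonneg_left hM₁ h11
    have a3 := mul_le_mul_of_nonneg_left hM₂ hβ
    have a4 := mul_le_mul_of_nonneg_left hE hγ
    nlinarith

end TwoSumAbsorb

end Summit.Ventures.PercRepro2
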